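import Literature.NumberTheory.IwasawaTheory.ClassicalMuVanishesNormRelationTower
import Literature.NumberTheory.NumberFields.ClassGroupExtension
import Mathlib.GroupTheory.Sylow
import HarnessLib

set_option autoImplicit false

/-!
# `μ = 0` descends to subfields of `p`-prime index: `e_n(K·F_∞/K) ≤ e_n(K'·F_∞/K')` for `K ⊆ K'`, `p ∤ [K' : K]`

Topic `NumberTheory/IwasawaTheory` (namespace = path).  THEOREM-ONLY file (no definition, no named fact, no `sorry`),
written by the literature seat `bsd-potss-conjA-anchor` g11 (cell `bsd-potss`; supports stmt-BirchSwinnertonDyer-19386 /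
19413; closes nothing).

For a tower of number fields `F ⊆ K ⊆ K'` and a `ℤ_p`-extension `κ` of `F` (layers `F_n ⊆ F̄`) with `κ ∘ res` onto for `K`
and `K'`: the `n`-th layers of the restricted towers are `j(K)·F_n ⊆ j'(K')·F_n ⊆ F̄` (`j = j' ∘ (K ⊆ K')`;
`ZpExtension.nonempty_ringEquiv_layer_restrict_fieldRange_sup_layer`, Washington §13.1), an extension of degree `[K' : K]`;
when `p ∤ [K' : K]` the extension map `Cl(j(K)F_n) → Cl(j'(K')F_n)` is injective on `p`-power torsion (Neukirch III (1.6)(ii)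
`N ∘ i = [·]^{[K':K]}`, tree `classGroupExtend_injOn_pow_eq_one`), so `ord_p h((K·F_∞)_n) ≤ ord_p h((K'·F_∞)_n)`.

* `nonempty_algEquiv_layer_restrict_fieldRange_sup_layer` — the `F`-ALGEBRA isomorphism
  `(κ.restrict M h).layer n ≃ₐ[F] ↥(j.fieldRange ⊔ κ.layer n)` (upgrade of the ring isomorphism of
  `ZpExtensionRestrictLayerCompositum.lean`), and `finrank_fieldRange_sup_layer`: `[j(M)·F_n : F] = [M : F]·pⁿ`.
* `padicValNat_card_le_of_injOn_pow` — a homomorphism of finite commutative groups injective on the `p`-power torsion does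
  not decrease `v_p` of the order (Sylow).
* `classNumberPExp_restrict_le_of_not_dvd_finrank` — **`e_n(κ|_K) ≤ e_n(κ|_{K'})` for `K ⊆ K'`, `p ∤ [K' : K]`.**
* `classicalMuVanishes_restrict_of_tower` — hence `μ(κ|_{K'}) = 0 ⇒ μ(κ|_K) = 0` (growth form; under the growth fact
  `iwasawa1959_classNumberPExp_growth`, through `classicalMuVanishes_of_le_sum`).
* `classicalMuVanishes_of_isCyclotomic_of_tower` — consumer form for the cyclotomic towers: `p ∤ [K' : F]`,
  «`μ = 0` for every cyclotomic `ℤ_p`-extension of `K'`» ⇒ the same for `K`.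

Use (cell `bsd-potss`, `p = 3` rows with image `N_ns(3) ≅ SD₁₆`): `ℚ(x(P)) ⊂ ℚ(P)` has degree `2`, so the quartic input
`μ(ℚ(x(P))) = 0` of the second Klein step (`ClassicalMuVanishesKleinDescent.lean`) follows from the octic input
`μ(ℚ(P)) = 0` of the first.

References: [Washington1997] §13.1 and §10.1; [NeukirchANT1999] Ch. III §1 Prop. (1.6) (ii); [Lang1990] Ch. 5 §1
Thm. 1.2 (iii).
-/

noncomputable section

open scoped NumberField

open Field IntermediateField Literature.NumberTheory.GaloisRepresentations Literature.NumberTheory.EllipticCurves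
  Literature.NumberTheory.EllipticCurves.ZpExtension Literature.NumberTheory.NumberFields

namespace Literature.NumberTheory.IwasawaTheory

/-! ### §0 Counting: `v_p` of the order along a homomorphism injective on `p`-power torsion -/

/-- `#M[p^k] = p^{v_p #M}` for `k ≥ v_p #M` (`M` a finite commutative group): the `p^k`-torsion is a `p`-group containing a
Sylow `p`-subgroup. [folklore] -/
private theorem card_torsion_eq_pow_factorization {M : Type*} [CommGroup M] [Finite M] {p : ℕ} [hp : Fact p.Prime]
    {k : ℕ} (hk : (Nat.card M).factorization p ≤ k) :
    Nat.card {m : M // m ^ p ^ k = 1} = p ^ (Nat.card M).factorization p := by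
  classical
  obtain ⟨P⟩ : Nonempty (Sylow p M) := inferInstance
  have hP : Nat.card P = p ^ (Nat.card M).factorization p := P.card_eq_multiplicity
  let T : Subgroup M := (powMonoidHom (p ^ k) : M →* M).ker
  have hT : ∀ m, m ∈ T ↔ m ^ p ^ k = 1 := fun m => Iff.rfl
  have hcardT : Nat.card {m : M // m ^ p ^ k = 1} = Nat.card T :=
    Nat.card_congr (Equiv.subtypeEquivRight fun m => (hT m).symm)
  have hPT : (P : Subgroup M) ≤ T := by
    intro x hx
    rw [hT, ← orderOf_dvd_iff_pow_eq_one]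
    exact (Subgroup.orderOf_dvd_natCard (P : Subgroup M) hx).trans (hP ▸ pow_dvd_pow p hk)
  have hTp : IsPGroup p T := fun x => ⟨k, Subtype.ext ((hT x.1).mp x.2)⟩
  obtain ⟨n, hn⟩ := IsPGroup.iff_card.mp hTp
  have hdvd : p ^ n ∣ Nat.card M := hn ▸ Subgroup.card_subgroup_dvd_card T
  have hn_le : n ≤ (Nat.card M).factorization p :=
    (hp.out.pow_dvd_iff_le_factorization Nat.card_pos.ne').mp hdvd
  have hle : Nat.card P ≤ Nat.card T := Subgroup.card_le_of_le hPT
  rw [hP, hn] at hle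
  have hge : (Nat.card M).factorization p ≤ n := (Nat.pow_le_pow_iff_right hp.out.one_lt).mp hle
  rw [hcardT, hn, le_antisymm hn_le hge]

/-- **A homomorphism injective on the `p`-power torsion does not decrease `v_p` of the order** (finite commutative
groups): the `p^k`-torsion of `M` (`#= p^{v_p #M}` for `k` large) injects into that of `N`. [folklore] -/
private theorem padicValNat_card_le_of_injOn_pow {M N : Type*} [CommGroup M] [Finite M] [CommGroup N] [Finite N]
    {p : ℕ} [hp : Fact p.Prime] (f : M →* N) (hf : Set.InjOn f {c : M | ∃ k : ℕ, c ^ p ^ k = 1}) :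
    padicValNat p (Nat.card M) ≤ padicValNat p (Nat.card N) := by
  set k := (Nat.card M).factorization p + (Nat.card N).factorization p with hk
  have h1 := card_torsion_eq_pow_factorization (M := M) (p := p) (k := k) (Nat.le_add_right _ _)
  have h2 := card_torsion_eq_pow_factorization (M := N) (p := p) (k := k) (Nat.le_add_left _ _)
  let Φ : {m : M // m ^ p ^ k = 1} → {x : N // x ^ p ^ k = 1} := fun m => ⟨f m.1, by rw [← map_pow, m.2, map_one]⟩
  have hΦ : Function.Injective Φ := by
    rintro ⟨m, hm⟩ ⟨m', hm'⟩ h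
    exact Subtype.ext (hf ⟨k, hm⟩ ⟨k, hm'⟩ (congrArg Subtype.val h))
  have hle : Nat.card {m : M // m ^ p ^ k = 1} ≤ Nat.card {x : N // x ^ p ^ k = 1} :=
    Nat.card_le_card_of_injective Φ hΦ
  rw [h1, h2] at hle
  rw [← Nat.factorization_def _ hp.out, ← Nat.factorization_def _ hp.out]
  exact (Nat.pow_le_pow_iff_right hp.out.one_lt).mp hle

variable {F : Type} [Field F] [NumberField F] {p : ℕ} [Fact p.Prime]

/-! ### §1 The layer `(M·F_∞)_n ≃ₐ[F] j(M)·F_n` and its degree -/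

/-- **`(κ.restrict M h).layer n ≃ₐ[F] ↥(j.fieldRange ⊔ κ.layer n)`** — the `F`-algebra form of
`ZpExtension.nonempty_ringEquiv_layer_restrict_fieldRange_sup_layer` (the `ι : F̄ ≅ M̄` of `absClosureEquiv` is `F`-linear, and
so is the conjugating `τ ∈ Gal(F̄/F)`). [cite: Washington1997, §13.1] -/
theorem nonempty_algEquiv_layer_restrict_fieldRange_sup_layer (κ : ZpExtension F p) (M : Type) [Field M]
    [NumberField M] [Algebra F M]
    (h : Function.Surjective (κ.toContinuousMonoidHom.comp (absGaloisRestrict F M)))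
    (j : M →ₐ[F] AlgebraicClosure F) (n : ℕ) :
    Nonempty (↥((κ.restrict M h).layer n) ≃ₐ[F] ↥(j.fieldRange ⊔ κ.layer n)) := by
  haveI : FiniteDimensional F M := Module.Finite.of_restrictScalars_finite ℚ F M
  set θ := absClosureEquiv F M with hθ
  have hmem : ∀ y : AlgebraicClosure F,
      y ∈ (absEmbedding F M).fieldRange ⊔ κ.layer n ↔ θ y ∈ (κ.restrict M h).layer n := fun y =>
    (mem_fieldRange_sup_layer_iff κ M n y).trans (absClosureEquiv_mem_layer_restrict_iff κ M h n y).symm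
  have hmem' : ∀ x : AlgebraicClosure M,
      x ∈ (κ.restrict M h).layer n ↔ θ.symm x ∈ (absEmbedding F M).fieldRange ⊔ κ.layer n := fun x => by
    rw [hmem, θ.apply_symm_apply]
  -- the `F`-algebra isomorphism for the chosen copy `e(M)`
  let e₁ : ↥((κ.restrict M h).layer n) ≃ₐ[F] ↥((absEmbedding F M).fieldRange ⊔ κ.layer n) :=
    { toFun := fun x => ⟨θ.symm x, (hmem' x).mp x.2⟩
      invFun := fun y => ⟨θ y, (hmem y).mp y.2⟩
      left_inv := fun x => Subtype.ext (θ.apply_symm_apply x)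
      right_inv := fun y => Subtype.ext (θ.symm_apply_apply y)
      map_mul' := fun x x' => Subtype.ext (map_mul θ.symm x.1 x'.1)
      map_add' := fun x x' => Subtype.ext (map_add θ.symm x.1 x'.1)
      commutes' := fun a => Subtype.ext (θ.symm.commutes a) }
  obtain ⟨τ, hτ⟩ := exists_algEquiv_apply_eq (absEmbedding F M) j
  obtain ⟨e₂⟩ := nonempty_algEquiv_fieldRange_sup_layer_of_apply_eq κ (absEmbedding F M) j τ hτ n
  exact ⟨e₁.trans e₂⟩

/-- **`[j(M)·F_n : F] = [M : F]·pⁿ`** (`[(M F_∞)_n : M] = pⁿ`, `finrank_layer_holds`, transported along the `F`-algebra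
isomorphism above). [cite: Washington1997, §13.1] -/
theorem finrank_fieldRange_sup_layer (κ : ZpExtension F p) (M : Type) [Field M] [NumberField M] [Algebra F M]
    (h : Function.Surjective (κ.toContinuousMonoidHom.comp (absGaloisRestrict F M)))
    (j : M →ₐ[F] AlgebraicClosure F) (n : ℕ) :
    Module.finrank F ↥(j.fieldRange ⊔ κ.layer n) = Module.finrank F M * p ^ n := by
  haveI : FiniteDimensional F M := Module.Finite.of_restrictScalars_finite ℚ F M
  obtain ⟨e⟩ := nonempty_algEquiv_layer_restrict_fieldRange_sup_layer κ M h j n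
  rw [← e.toLinearEquiv.finrank_eq, ← Module.finrank_mul_finrank F M ↥((κ.restrict M h).layer n),
    (κ.restrict M h).finrank_layer_holds n]

/-! ### §2 Monotonicity of `e_n` and descent of `μ = 0` to subfields of `p`-prime index -/

/-- **`e_n(κ|_K) ≤ e_n(κ|_{K'})` for `F ⊆ K ⊆ K'` with `p ∤ [K' : K]`**: the `n`-th layers are `j(K)·F_n ⊆ j'(K')·F_n`
(`j = j'|_K`), an extension of number fields of degree `[K' : K]`; for `p ∤ [K' : K]` the extension of ideal classes is
injective on `p`-power torsion (Neukirch III (1.6)(ii), `classGroupExtend_injOn_pow_eq_one`), so `v_p #Cl` does not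
decrease. [cite: NeukirchANT1999, Ch. III §1 Prop. (1.6) (ii)] [cite: Washington1997, §13.1] -/
theorem classNumberPExp_restrict_le_of_not_dvd_finrank (κ : ZpExtension F p) (K K' : Type) [Field K]
    [NumberField K] [Algebra F K] [Field K'] [NumberField K'] [Algebra F K'] [Algebra K K']
    [IsScalarTower F K K'] (hpd : ¬ p ∣ Module.finrank K K')
    (hK : Function.Surjective (κ.toContinuousMonoidHom.comp (absGaloisRestrict F K)))
    (hK' : Function.Surjective (κ.toContinuousMonoidHom.comp (absGaloisRestrict F K'))) (n : ℕ) :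
    classNumberPExp (κ.restrict K hK) n ≤ classNumberPExp (κ.restrict K' hK') n := by
  haveI : FiniteDimensional F K := Module.Finite.of_restrictScalars_finite ℚ F K
  haveI : FiniteDimensional F K' := Module.Finite.of_restrictScalars_finite ℚ F K'
  haveI : FiniteDimensional K K' := Module.Finite.of_restrictScalars_finite F K K'
  set j' : K' →ₐ[F] AlgebraicClosure F := absEmbedding F K' with hj'
  set j : K →ₐ[F] AlgebraicClosure F := j'.comp (IsScalarTower.toAlgHom F K K') with hj
  set A : IntermediateField F (AlgebraicClosure F) := j.fieldRange ⊔ κ.layer n with hA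
  set B : IntermediateField F (AlgebraicClosure F) := j'.fieldRange ⊔ κ.layer n with hB
  have hAB : A ≤ B := by
    refine sup_le_sup_right ?_ _
    rintro _ ⟨x, rfl⟩
    exact ⟨IsScalarTower.toAlgHom F K K' x, rfl⟩
  haveI : NumberField ↥A := numberField_fieldRange_sup_layer κ K j n
  haveI : NumberField ↥B := numberField_fieldRange_sup_layer κ K' j' n
  letI : Algebra ↥A ↥B := (IntermediateField.inclusion hAB).toRingHom.toAlgebra
  haveI : IsScalarTower F ↥A ↥B := IsScalarTower.of_algebraMap_eq fun x => rfl
  haveI : Module.Free ↥A ↥B := Module.Free.of_divisionRing ↥A ↥B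
  -- degrees: `[B : A] = [K' : K]`
  have hdA : Module.finrank F ↥A = Module.finrank F K * p ^ n := finrank_fieldRange_sup_layer κ K hK j n
  have hdB : Module.finrank F ↥B = Module.finrank F K' * p ^ n := finrank_fieldRange_sup_layer κ K' hK' j' n
  have htower := Module.finrank_mul_finrank F ↥A ↥B
  have hKK' := Module.finrank_mul_finrank F K K'
  have hA0 : 0 < Module.finrank F ↥A := Module.finrank_pos
  have hdeg : Module.finrank ↥A ↥B = Module.finrank K K' := by
    have h1 : Module.finrank F ↥A * Module.finrank ↥A ↥B = Module.finrank F ↥A * Module.finrank K K' := by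
      rw [htower, hdB, hdA, ← hKK']
      ring
    exact Nat.eq_of_mul_eq_mul_left hA0 h1
  have hpd' : ¬ p ∣ Module.finrank ↥A ↥B := hdeg ▸ hpd
  -- injectivity on `p`-power torsion, counting
  have hinj := classGroupExtend_injOn_pow_eq_one ↥A ↥B (Fact.out : p.Prime) hpd'
  have hle := padicValNat_card_le_of_injOn_pow (classGroupExtend ↥A ↥B) hinj
  rw [classNumberPExp_def, classNumberPExp_def, natCard_classGroup_layer_restrict_eq κ K hK j n,
    natCard_classGroup_layer_restrict_eq κ K' hK' j' n]
  exact hle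

/-- **`μ = 0` descends along `K ⊆ K'` with `p ∤ [K' : K]`** (growth form): `μ(κ|_{K'}) = 0 ⇒ μ(κ|_K) = 0`, under Iwasawa's
growth theorem (`classicalMuVanishes_of_le_sum` with the single bound `e_n(κ|_K) ≤ e_n(κ|_{K'})`).
[cite: NeukirchANT1999, Ch. III §1 Prop. (1.6) (ii)] [cite: Lang1990, Ch. 5 §1 Thm. 1.2 (iii) (pp. 124–129)] -/
theorem classicalMuVanishes_restrict_of_tower (hI : iwasawa1959_classNumberPExp_growth) (κ : ZpExtension F p)
    (K K' : Type) [Field K] [NumberField K] [Algebra F K] [Field K'] [NumberField K'] [Algebra F K'] [Algebra K K']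
    [IsScalarTower F K K'] (hpd : ¬ p ∣ Module.finrank K K')
    (hK : Function.Surjective (κ.toContinuousMonoidHom.comp (absGaloisRestrict F K)))
    (hK' : Function.Surjective (κ.toContinuousMonoidHom.comp (absGaloisRestrict F K')))
    (hμ : ClassicalMuVanishes (κ.restrict K' hK')) : ClassicalMuVanishes (κ.restrict K hK) := by
  refine classicalMuVanishes_of_le_sum hI (κ.restrict K hK) (ι := Unit) (κs := fun _ => κ.restrict K' hK')
    (c := fun _ => 1) (b := 0) (n₀ := 0) (fun n _ => ?_) (fun _ => hμ)
  simpa using classNumberPExp_restrict_le_of_not_dvd_finrank κ K K' hpd hK hK' n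

/-- **Consumer form (cyclotomic towers): `μ = 0` for every cyclotomic `ℤ_p`-extension of `K'` ⇒ the same for every subfield
`K ⊇ F` of `K'` with `p ∤ [K' : F]`** (`κ` the cyclotomic `ℤ_p`-extension of `F`; the restrictions are cyclotomic,
`isCyclotomic_restrict`, and all cyclotomic towers of a field share their layers). [cite: Washington1997, §13.1]
[cite: NeukirchANT1999, Ch. III §1 Prop. (1.6) (ii)] -/
theorem classicalMuVanishes_of_isCyclotomic_of_tower (hI : iwasawa1959_classNumberPExp_growth)
    (κ : ZpExtension F p) (hκ : κ.IsCyclotomic) (K K' : Type) [Field K] [NumberField K] [Algebra F K] [Field K']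
    [NumberField K'] [Algebra F K'] [Algebra K K'] [IsScalarTower F K K'] (hp : ¬ p ∣ Module.finrank F K')
    (hμ : ∀ κ' : ZpExtension K' p, κ'.IsCyclotomic → ClassicalMuVanishes κ')
    (κK : ZpExtension K p) (hκK : κK.IsCyclotomic) : ClassicalMuVanishes κK := by
  haveI : FiniteDimensional F K := Module.Finite.of_restrictScalars_finite ℚ F K
  haveI : FiniteDimensional F K' := Module.Finite.of_restrictScalars_finite ℚ F K'
  haveI : FiniteDimensional K K' := Module.Finite.of_restrictScalars_finite F K K'
  have hKK' := Module.finrank_mul_finrank F K K'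
  have hpK : ¬ p ∣ Module.finrank F K := fun h => hp (hKK' ▸ dvd_mul_of_dvd_left h _)
  have hpd : ¬ p ∣ Module.finrank K K' := fun h => hp (hKK' ▸ dvd_mul_of_dvd_right h _)
  have hK := surjective_comp_absGaloisRestrict_of_not_dvd_finrank κ K hpK
  have hK' := surjective_comp_absGaloisRestrict_of_not_dvd_finrank κ K' hp
  have h1 : ClassicalMuVanishes (κ.restrict K hK) :=
    classicalMuVanishes_restrict_of_tower hI κ K K' hpd hK hK' (hμ _ (isCyclotomic_restrict κ hκ K' hK'))
  exact (classicalMuVanishes_iff_of_isCyclotomic _ _ (isCyclotomic_restrict κ hκ K hK) hκK).mp h1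

end Literature.NumberTheory.IwasawaTheory

end
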